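import Summits.BirchSwinnertonDyer.BirchSwinnertonDyer.Theorems.RamifiedSevenEllipticUnitsStrictControlStrictConj
import Summits.BirchSwinnertonDyer.BirchSwinnertonDyer.Theorems.RamifiedSevenEllipticUnitsStrictControlKummerAway
import Summits.BirchSwinnertonDyer.Rank1Residual.X11b.AnticyclotomicEmbedding
import Literature.NumberTheory.EllipticCurves.BSDQuadraticDescentShaOddPartProofs
import Literature.NumberTheory.EllipticCurves.SelmerPInftyModelAction
import Literature.NumberTheory.EllipticCurves.LocalRestrictionDegree
import Mathlib.NumberTheory.Padics.HeightOneSpectrum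
import HarnessLib

set_option linter.dupNamespace false
set_option autoImplicit false

/-!
# Route `RamifiedSevenEllipticUnits` (rung K7r), crux `StrictControlSeven` (stmt-BirchSwinnertonDyer-19145):
# the `±`-decomposition for the STRICT `p^∞`-Selmer groups (brick (s5) of the twist-descent step)

Cell `bsd-cm`, seat `bsd-cm-k7r-c4` (g0). HONEST FRAMING: nothing here closes the crux; BSD is not
proved by any of this. This file runs Dokchitser–Dokchitser's `±`-decomposition (Ann. of Math. 172
(2010), Lemma 4.14, proof; the tree's `IndexTwoDecompositionData` of `H1CorestrictionIndexTwo` and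
its instantiation `BSDSelmerParityDokchitserBaseChangeProofs.decompData` for `Sel_{p^∞}`) for the
STRICT groups: for `E = W/ℚ`, `K = ℚ(θ)`, `θ² = c`, and an ODD prime `p`,

  `#{s ∈ H¹(K, E[p^∞]) : s ↦ 0 in H¹(K_v, E(K̄_v)[p^∞]) for every finite v}`
    `= #Sel_str(E/ℚ)[p^∞] · #Sel_str(E^{(c)}/ℚ)[p^∞]`                                   (`Nat.card`)

where `Sel_str(X/ℚ)[p^∞] = strictSelmerPInfty X p = Sel_{p^∞}(X/ℚ) ⊓ ker(→ H¹(ℚ_p, X(ℚ̄_p)[p^∞]))`.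
The data: `N = galRange K`, `c₀ = liftToAbsGal K σ₀`, `M = E[p^∞]`, `M' = E^{(c)}[p^∞]`, `ψ = psiQ`,
`S = Sel_str(E/ℚ)[p^∞]`, `S' = Sel_str(E^{(c)}/ℚ)[p^∞]`, `T` = the image under `modelIso` of the
everywhere-strict subgroup `T_K = ⨅_v ker(H¹(K, E[p^∞]) → H¹(K_v, E(K̄_v)[p^∞]))`, `a = 2`. The
inputs `res S ⊆ T`, `ψ_* res S' ⊆ T`, `c₀_* T ⊆ T`, `res η ∈ T ⇒ 4η ∈ S` are the bricks of the
sibling files (`…KummerAway`: the classical condition at `v ∤ p` IS the strict one;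
`…StrictTower`: strict conditions along `ℚ → ℚ_p → K_𝔮` and back up to `[K_𝔮 : ℚ_p] ≤ 2`;
`…StrictConj`: `Aut(K/ℚ)`-stability and the `hPsiK` transport). The structure is built INSIDE the
proof of the count (no definition is introduced).

## What is proved

* `selmerLocalKerPrimaryTorsion_le_of_algHom` — strict conditions grow along `K`-algebra maps
  `E →ₐ[K] E'` (tower lemma with the induced algebra structure).
* `resPrimary_mem_iInf_selmerLocalKerPrimaryTorsion` — **`res Sel_str(X/ℚ)[p^∞] ⊆ T_K`**.
* `four_nsmul_mem_strictSelmerPInfty_of_resPrimary_mem` — **`res η ∈ T_K ⇒ 4η ∈ Sel_str(X/ℚ)[p^∞]`**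
  (`[K : ℚ] = 2`).
* `natCard_iInf_selmerLocalKerPrimaryTorsion_eq_mul` — **the strict `±`-count** displayed above.

References: [DokchitserDokchitserAnnals2010] Lemma 4.14 (proof); [Dokchitser2013ParityNotes] §4;
[SerreGaloisCohomology1997] I.§2.4; [MilneADT2006] I.§6; [GreenbergLNM1716] §2.
-/

noncomputable section

open scoped Classical

open WeierstrassCurve NumberField IsDedekindDomain
  Literature.NumberTheory.EllipticCurves
  Literature.NumberTheory.GaloisRepresentations
  Summit.BirchSwinnertonDyer.Rank1Residual.Additive
  Summit.BirchSwinnertonDyer.Rank1Residual.X11b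

universe u

namespace Summit.BirchSwinnertonDyer.BirchSwinnertonDyer.Theorems.RamifiedSevenEllipticUnits

/-! ## §1 Strict conditions along `K`-algebra maps -/

section AlgHom

variable {K : Type u} [Field K] (W : WeierstrassCurve K) (p : ℕ)
variable {E E' : Type u} [Field E] [Algebra K E] [Field E'] [Algebra K E']

/-- **Strict local conditions grow along `K`-algebra maps**: for `f : E →ₐ[K] E'`, a class of
`H¹(K, E[p^∞])` dying in `H¹(E, E(K̄_E)[p^∞])` dies in `H¹(E', E(K̄_{E'})[p^∞])`
(`selmerLocalKerPrimaryTorsion_le_of_tower` for the algebra structure induced by `f`). In particular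
isomorphic `K`-fields (`ℚ_p ≃ ℚ_{(p)}`, `Padic.adicCompletionEquiv`) have the same strict condition.
[cite: SerreGaloisCohomology1997, I.§2.4 and II.§1.1] -/
theorem selmerLocalKerPrimaryTorsion_le_of_algHom (f : E →ₐ[K] E') :
    selmerLocalKerPrimaryTorsion W E p ≤ selmerLocalKerPrimaryTorsion W E' p := by
  letI : Algebra E E' := f.toRingHom.toAlgebra
  haveI : IsScalarTower K E E' := IsScalarTower.of_algebraMap_eq fun x ↦ (f.commutes x).symm
  exact selmerLocalKerPrimaryTorsion_le_of_tower W p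

end AlgHom

/-! ## §2 `res Sel_str ⊆ T_K` and `res η ∈ T_K ⇒ 4η ∈ Sel_str` -/

section Descent

variable (X : WeierstrassCurve ℚ) [X.IsElliptic] (K : Type) [Field K] [NumberField K] (p : ℕ)
  [hp : Fact p.Prime]

/-- `ℚ ⊂ K ⊂ K_v` is a scalar tower for the `ℚ`-algebra structure of the characteristic-zero field
`K_v` (ring homomorphisms commute with `Rat.cast`). [folklore] -/
theorem isScalarTower_rat_adicCompletion (v : HeightOneSpectrum (𝓞 K))
    [CharZero (v.adicCompletion K)] : IsScalarTower ℚ K (v.adicCompletion K) :=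
  IsScalarTower.of_algebraMap_eq fun x ↦ by
    rw [eq_ratCast (algebraMap ℚ K) x, map_ratCast, eq_ratCast]

/-- **`res_{K/ℚ}` maps `Sel_str(X/ℚ)[p^∞]` into the everywhere-strict subgroup `T_K`.** At a finite
place `v ∤ p` of `K`: `res η ∈ Sel_{p^∞}(X/K)` (`resPrimary_mem_selmerGroupPInfty`) satisfies the
classical condition at `v`, which IS the strict one (`selmerLocalKerPrimary_adicCompletion_eq_of_not_mem`,
Kummer vanishing off `p`). At `v ∣ p`: `η` dies in `H¹(ℚ_p, X(ℚ̄_p)[p^∞])`, hence in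
`H¹(K_v, X(K̄_v)[p^∞])` (`ℚ_p ≃ ℚ_{(p)} → K_v`, `selmerLocalKerPrimaryTorsion_le_of_algHom`), which is
the strict condition of `res η` at `v` (`mem_selmerLocalKerPrimaryTorsion_iff_resPrimary_mem`).
[cite: DokchitserDokchitserAnnals2010, Lemma 4.14 (proof)] [cite: GreenbergLNM1716, §2] -/
theorem resPrimary_mem_iInf_selmerLocalKerPrimaryTorsion {η : galH1Primary X p}
    (hη : η ∈ strictSelmerPInfty X p) :
    resPrimary X K p η ∈ ⨅ v : HeightOneSpectrum (𝓞 K),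
      selmerLocalKerPrimaryTorsion (X.baseChange K) (v.adicCompletion K) p := by
  rw [strictSelmerPInfty_def, AddSubgroup.mem_inf] at hη
  rw [AddSubgroup.mem_iInf]
  intro v
  by_cases hpv : ((p : ℕ) : 𝓞 K) ∈ v.asIdeal
  · haveI : v.asIdeal.LiesOver (ratPlace p).asIdeal :=
      ⟨by rw [← under_eq_ratPlace_of_mem hpv]; rfl⟩
    haveI : CharZero (v.adicCompletion K) :=
      charZero_of_injective_algebraMap (algebraMap K _).injective
    haveI : CharZero ((ratPlace p).adicCompletion ℚ) :=
      charZero_of_injective_algebraMap (algebraMap ℚ _).injective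
    haveI := isScalarTower_rat_adicCompletion K v
    have e : ℚ_[p] →+* (ratPlace p).adicCompletion ℚ :=
      (Padic.adicCompletionEquiv (𝓞 ℚ) ⟨p, hp.out⟩).toAlgEquiv.toRingEquiv.toRingHom
    have h1 : η ∈ selmerLocalKerPrimaryTorsion X ((ratPlace p).adicCompletion ℚ) p :=
      selmerLocalKerPrimaryTorsion_le_of_algHom X p e.toRatAlgHom hη.2
    have h2 : η ∈ selmerLocalKerPrimaryTorsion X (v.adicCompletion K) p :=
      selmerLocalKerPrimaryTorsion_le_of_algHom X p
        (adicCompletionMap (K := ℚ) K (ratPlace p) v).toRatAlgHom h1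
    exact (mem_selmerLocalKerPrimaryTorsion_iff_resPrimary_mem X p K η).mp h2
  · haveI : (X.baseChange K).IsElliptic := by rw [baseChange]; infer_instance
    rw [← selmerLocalKerPrimary_adicCompletion_eq_of_not_mem (X.baseChange K) v p hpv]
    exact (WeierstrassCurve.mem_finSelmerGroupPInfty_iff _ _ _).mp
      ((X.baseChange K).selmerGroupPInfty_le_finSelmerGroupPInfty p
        (resPrimary_mem_selmerGroupPInfty X K p hη.1)) v

omit [X.IsElliptic] in
/-- **`res η ∈ T_K ⇒ 4η ∈ Sel_str(X/ℚ)[p^∞]`** for `[K : ℚ] = 2` and a prime `𝔮 ∣ p` of `K`. The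
classical part: `T_K ⊆ finSelmerGroupPInfty` (`selmerLocalKerPrimaryTorsion_le_selmerLocalKerPrimary`)
and `four_nsmul_mem_selmerGroupPInfty_of_resPrimary_mem`. The strict part at `p`: the strict
condition of `res η` at `𝔮` is the strict condition of `η` at the `ℚ`-field `K_𝔮`
(`mem_selmerLocalKerPrimaryTorsion_iff_resPrimary_mem`), which descends to `ℚ_{(p)} ≃ ℚ_p` after
multiplication by `2 ∣ 4` since `[K_𝔮 : ℚ_p] ≤ [K : ℚ] = 2`
(`two_nsmul_mem_selmerLocalKerPrimaryTorsion_of_tower`, `finrank_adicCompletion_le_of_liesOver`).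
[cite: DokchitserDokchitserAnnals2010, Lemma 4.14 (proof)] [cite: SerreGaloisCohomology1997, I.§2.4 Cor. to Prop. 9] -/
theorem four_nsmul_mem_strictSelmerPInfty_of_resPrimary_mem (h2 : Module.finrank ℚ K = 2)
    {𝔮 : HeightOneSpectrum (𝓞 K)} (h𝔮 : ((p : ℕ) : 𝓞 K) ∈ 𝔮.asIdeal) {η : galH1Primary X p}
    (hη : resPrimary X K p η ∈ ⨅ v : HeightOneSpectrum (𝓞 K),
      selmerLocalKerPrimaryTorsion (X.baseChange K) (v.adicCompletion K) p) :
    4 • η ∈ strictSelmerPInfty X p := by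
  rw [AddSubgroup.mem_iInf] at hη
  rw [strictSelmerPInfty_def, AddSubgroup.mem_inf]
  constructor
  · apply four_nsmul_mem_selmerGroupPInfty_of_resPrimary_mem K h2 p X
    rw [WeierstrassCurve.mem_finSelmerGroupPInfty_iff]
    exact fun v ↦ selmerLocalKerPrimaryTorsion_le_selmerLocalKerPrimary _ _ p (hη v)
  · haveI : 𝔮.asIdeal.LiesOver (ratPlace p).asIdeal :=
      ⟨by rw [← under_eq_ratPlace_of_mem h𝔮]; rfl⟩
    haveI : CharZero (𝔮.adicCompletion K) :=
      charZero_of_injective_algebraMap (algebraMap K _).injective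
    haveI : CharZero ((ratPlace p).adicCompletion ℚ) :=
      charZero_of_injective_algebraMap (algebraMap ℚ _).injective
    haveI := isScalarTower_rat_adicCompletion K 𝔮
    have h1 : η ∈ selmerLocalKerPrimaryTorsion X (𝔮.adicCompletion K) p :=
      (mem_selmerLocalKerPrimaryTorsion_iff_resPrimary_mem X p K η).mpr (hη 𝔮)
    letI : Algebra ((ratPlace p).adicCompletion ℚ) (𝔮.adicCompletion K) :=
      (adicCompletionMap (K := ℚ) K (ratPlace p) 𝔮).toAlgebra
    haveI : IsScalarTower ℚ ((ratPlace p).adicCompletion ℚ) (𝔮.adicCompletion K) :=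
      IsScalarTower.of_algebraMap_eq fun x ↦ by
        rw [eq_ratCast (algebraMap ℚ ((ratPlace p).adicCompletion ℚ)) x, RingHom.algebraMap_toAlgebra,
          map_ratCast, eq_ratCast]
    obtain ⟨hfin, hle⟩ := finrank_adicCompletion_le_of_liesOver (K := ℚ) K (ratPlace p) 𝔮
    haveI := hfin
    rw [h2] at hle
    have h2η : 2 • η ∈ selmerLocalKerPrimaryTorsion X ((ratPlace p).adicCompletion ℚ) p :=
      two_nsmul_mem_selmerLocalKerPrimaryTorsion_of_tower (E := (ratPlace p).adicCompletion ℚ) X p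
        hle h1
    have h4η : 4 • η ∈ selmerLocalKerPrimaryTorsion X ((ratPlace p).adicCompletion ℚ) p := by
      rw [show (4 : ℕ) • η = 2 • (2 • η) by rw [smul_smul]; norm_num]
      exact AddSubgroup.nsmul_mem _ h2η 2
    have e' : (ratPlace p).adicCompletion ℚ →+* ℚ_[p] :=
      (Padic.adicCompletionEquiv (𝓞 ℚ) ⟨p, hp.out⟩).symm.toAlgEquiv.toRingEquiv.toRingHom
    exact selmerLocalKerPrimaryTorsion_le_of_algHom X p e'.toRatAlgHom h4η

end Descent

/-! ## §3 The strict `±`-count -/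

section Count

variable (W : WeierstrassCurve ℚ) [W.IsElliptic] (K : Type) [Field K] [NumberField K]
  (h2 : Module.finrank ℚ K = 2) {θ : K} {c : ℚ} (hθ : θ ∉ Set.range (algebraMap ℚ K))
  (hc : θ ^ 2 = algebraMap ℚ K c) (p : ℕ) [hp : Fact p.Prime]

include h2 hθ hc in
/-- **The strict `±`-count: `#T_K = #Sel_str(E/ℚ)[p^∞] · #Sel_str(E^{(c)}/ℚ)[p^∞]` for odd `p`**,
`K = ℚ(θ)`, `θ² = c`, `𝔮 ∣ p` a prime of `K`, `T_K = ⨅_v ker(H¹(K, E[p^∞]) → H¹(K_v, E(K̄_v)[p^∞]))`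
the everywhere-strict subgroup. Proof: the `±`-decomposition data (`IndexTwoDecompositionData`,
built inside the proof: `N = galRange K`, `c₀ = liftToAbsGal K σ₀`, `ψ = psiQ`, `S`, `S'` the strict
groups, `T = modelIso(T_K)`, `a = 2`; inputs `resPrimary_mem_iInf_selmerLocalKerPrimaryTorsion`,
`mem_iInf_selmerLocalKerPrimaryTorsion_iff_hPsiK_mem`, `conjH1Primary_mem_iInf_selmerLocalKerPrimaryTorsion`,
`four_nsmul_mem_strictSelmerPInfty_of_resPrimary_mem`) give a comparison map `S × S' → T` with kernel
killed by `4` and cokernel killed by `8` (`nsmul_eq_zero_of_decompMap_eq_zero`,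
`pow_nsmul_mem_range_decompMap`); all groups are `p`-primary with `p` odd, so it is bijective
(`bijective_of_two_pow_nsmul_ker_of_two_pow_nsmul_coker`).
[cite: DokchitserDokchitserAnnals2010, Lemma 4.14 (proof)] [cite: Dokchitser2013ParityNotes, §4, proof of the Theorem "[Squarity, NekIV, Kurast]"] -/
theorem natCard_iInf_selmerLocalKerPrimaryTorsion_eq_mul (hodd : Odd p)
    {𝔮 : HeightOneSpectrum (𝓞 K)} (h𝔮 : ((p : ℕ) : 𝓞 K) ∈ 𝔮.asIdeal) :
    Nat.card ↥(⨅ v : HeightOneSpectrum (𝓞 K),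
        selmerLocalKerPrimaryTorsion (W.baseChange K) (v.adicCompletion K) p) =
      Nat.card ↥(strictSelmerPInfty W p) * Nat.card ↥(strictSelmerPInfty (W.quadraticTwist c) p) := by
  classical
  have hc0 : c ≠ 0 := by
    rintro rfl
    apply hθ
    refine ⟨0, ?_⟩
    rw [map_zero] at hc ⊢
    exact (pow_eq_zero_iff two_ne_zero).mp hc |>.symm
  haveI : (W.quadraticTwist c).IsElliptic := W.isElliptic_quadraticTwist hc0
  haveI : IsGalois ℚ K := isGalois_of_finrank_eq_two K h2
  haveI := normal_galRange K h2 (sigmaQ_ne_one K h2 hθ hc)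
  set TK : AddSubgroup (galH1Primary (W.baseChange K) p) := ⨅ v : HeightOneSpectrum (𝓞 K),
    selmerLocalKerPrimaryTorsion (W.baseChange K) (v.adicCompletion K) p with hTK
  -- the `±`-decomposition data for the strict groups
  let D : IndexTwoDecompositionData (galRange (K := ℚ) K)
      (liftToAbsGal (K := ℚ) K (sigmaQ K h2 hθ hc))
      (geomPrimaryTorsion W p) (geomPrimaryTorsion (W.quadraticTwist c) p) :=
    { isOpen := isOpen_galRange K
      xor := xor_galRange K h2 (sigmaQ_ne_one K h2 hθ hc)
      continuous_smul := continuous_smul_geomPrimaryTorsion W p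
      continuous_smul' := continuous_smul_geomPrimaryTorsion (W.quadraticTwist c) p
      ψ := psiQ W K hθ hc p
      hψ := psiQ_smul W K hθ hc p
      hψc := psiQ_smul_liftToAbsGal W K h2 hθ hc p
      S := strictSelmerPInfty W p
      S' := strictSelmerPInfty (W.quadraticTwist c) p
      T := TK.map (modelIso K W p).toAddMonoidHom
      res_mem := fun η hη ↦ by
        refine ⟨resPrimary W K p η, resPrimary_mem_iInf_selmerLocalKerPrimaryTorsion W K p hη, ?_⟩
        rw [AddEquiv.coe_toAddMonoidHom, modelIso_resPrimary]
        rfl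
      res_mem' := fun η' hη' ↦ by
        refine ⟨hPsiK W K hθ hc p (resPrimary (W.quadraticTwist c) K p η'), ?_, ?_⟩
        · exact (mem_iInf_selmerLocalKerPrimaryTorsion_iff_hPsiK_mem W K hθ hc p _).mp
            (resPrimary_mem_iInf_selmerLocalKerPrimaryTorsion (W.quadraticTwist c) K p hη')
        · rw [AddEquiv.coe_toAddMonoidHom, ← h1Equiv_psiQ_modelIso, modelIso_resPrimary]
          rfl
      conj_mem := by
        rintro _ ⟨s, hs, rfl⟩
        exact ⟨(isLiftOfAut_liftAut (sigmaQ K h2 hθ hc)).conjH1Primary W p s,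
          conjH1Primary_mem_iInf_selmerLocalKerPrimaryTorsion W p _ hs,
          modelIso_conjH1Primary K W p (sigmaQ K h2 hθ hc) h2 (sigmaQ_ne_one K h2 hθ hc) s⟩
      a := 2
      mem_of_res_mem := by
        rintro η ⟨s, hs, hsη⟩
        apply four_nsmul_mem_strictSelmerPInfty_of_resPrimary_mem W K p h2 h𝔮
        have : modelIso K W p s = modelIso K W p (resPrimary W K p η) := by
          rw [AddEquiv.coe_toAddMonoidHom] at hsη
          rw [hsη, modelIso_resPrimary]; rfl
        rwa [← (modelIso K W p).injective this]
      mem_of_res_mem' := by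
        rintro η' ⟨s, hs, hsη⟩
        apply four_nsmul_mem_strictSelmerPInfty_of_resPrimary_mem (W.quadraticTwist c) K p h2 h𝔮
        rw [mem_iInf_selmerLocalKerPrimaryTorsion_iff_hPsiK_mem W K hθ hc p]
        have : modelIso K W p s =
            modelIso K W p (hPsiK W K hθ hc p (resPrimary (W.quadraticTwist c) K p η')) := by
          rw [AddEquiv.coe_toAddMonoidHom] at hsη
          rw [hsη, ← h1Equiv_psiQ_modelIso, modelIso_resPrimary]; rfl
        rwa [← (modelIso K W p).injective this] }
  -- all three groups are `p`-primary
  have hS : ∀ x : D.S × D.S', ∃ k : ℕ, (p ^ k) • x = 0 := fun x ↦ by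
    obtain ⟨k₁, hk₁⟩ := exists_pow_nsmul_eq_zero_galH1Primary W p (x.1 : galH1Primary W p)
    obtain ⟨k₂, hk₂⟩ := exists_pow_nsmul_eq_zero_galH1Primary (W.quadraticTwist c) p
      (x.2 : galH1Primary (W.quadraticTwist c) p)
    have h₁ : (p ^ k₁) • x.1 = 0 :=
      Subtype.ext (by rw [AddSubmonoidClass.coe_nsmul, hk₁, ZeroMemClass.coe_zero])
    have h₂ : (p ^ k₂) • x.2 = 0 :=
      Subtype.ext (by rw [AddSubmonoidClass.coe_nsmul, hk₂, ZeroMemClass.coe_zero])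
    refine ⟨k₁ + k₂, Prod.ext ?_ ?_⟩
    · rw [Prod.smul_fst, pow_add, mul_comm, mul_smul, h₁, smul_zero, Prod.fst_zero]
    · rw [Prod.smul_snd, pow_add, mul_smul, h₂, smul_zero, Prod.snd_zero]
  have hT : ∀ y : D.T, ∃ k : ℕ, (p ^ k) • y = 0 := fun y ↦ by
    obtain ⟨s, -, hsy⟩ := y.2
    obtain ⟨k, hk⟩ := exists_pow_nsmul_eq_zero_galH1Primary (W.baseChange K) p s
    refine ⟨k, Subtype.ext ?_⟩
    rw [AddSubmonoidClass.coe_nsmul, ZeroMemClass.coe_zero, ← hsy, AddEquiv.coe_toAddMonoidHom,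
      ← map_nsmul, hk, map_zero]
  -- the comparison map is bijective for odd `p`
  have hbij : Function.Bijective D.decompMap :=
    bijective_of_two_pow_nsmul_ker_of_two_pow_nsmul_coker hodd D.decompMap hS hT (a := 3)
      (fun x hx ↦ by
        have h4 : (4 : ℕ) • x = 0 := D.nsmul_eq_zero_of_decompMap_eq_zero x hx
        rw [show (2 : ℕ) ^ 3 • x = 2 • ((4 : ℕ) • x) by rw [smul_smul]; norm_num, h4, smul_zero])
      (fun y ↦ D.pow_nsmul_mem_range_decompMap y)
  -- count
  have e1 : Nat.card (D.S × D.S') = Nat.card D.T := Nat.card_congr (Equiv.ofBijective _ hbij)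
  have e2 : Nat.card D.T = Nat.card TK :=
    Nat.card_congr ((modelIso K W p).addSubgroupMap TK).symm.toEquiv
  rw [Nat.card_prod] at e1
  change Nat.card ↥(strictSelmerPInfty W p) * Nat.card ↥(strictSelmerPInfty (W.quadraticTwist c) p) =
    _ at e1
  rw [e1, e2]

end Count

end Summit.BirchSwinnertonDyer.BirchSwinnertonDyer.Theorems.RamifiedSevenEllipticUnits

end
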